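import Summits.QuantumFields.YangMills.Theses.SmallCircleAnchor
import Literature.MathematicalPhysics.QuantumLattice.YangMillsClassical
import Literature.RepresentationTheory.CompactGroups.MaximalTorusCentralizer

/-!
# Route `SmallCircleAnchor` of `YangMills`: the abelianising deformation (`OneLayerAnchor`, `AnchorGap`, `PolyakovAnchorClustering`)

Support item `stmt-QuantumFields-11143`
(`Summit.QuantumFields.YangMills.Theses.SmallCircleAnchor.OneLayerAnchor`) asserts, for every
compact simple `G` and faithful unitary lattice representation `r`, the existence of an
ABELIANISING DEFORMATION `V : G → ℝ` — continuous, a class function, minimised exactly on one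
conjugacy class `Cl(g₀)` whose centraliser `C_G(g₀)` is abelian — such that the one-time-layer
pinned Wilson theory (three-dimensional lattice `G`-gauge theory with a `G`-valued adjoint Higgs
pinned to `Cl(g₀)`) clusters exponentially in space, uniformly in the volume, for all large `β`.

This file separates the Lie-theoretic part of the item from its analytic part:

* `exists_abelianisingDeformation_of_abelian_centralizer` (unconditional): from ANY element `g₀`
  with abelian centraliser, the Frobenius distance of `r.ρ g` to the compact set `r.ρ(Cl(g₀))`
  is an abelianising deformation — continuous (1-Lipschitz in `r.ρ g`), a class function (unitary
  conjugation is a Frobenius isometry preserving `r.ρ(Cl(g₀))`), `≥ 0` with equality exactly on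
  `Cl(g₀)` (closed orbit, `r` injective).
* the Lie-theoretic input, taken as an explicit HYPOTHESIS `hfact` spelled out verbatim (it is
  the named fact `Literature.RepresentationTheory.CompactGroups.compactLie_exists_abelian_centralizer`,
  Bröcker–tom Dieck IV (2.3)(i) with Kronecker's theorem I (4.13), proposed separately under
  `Literature/RepresentationTheory/CompactGroups/MaximalTorusCentralizer.lean`; a holder of that
  fact passes it directly, the `def` unfolds): a compact connected group with a faithful
  continuous matrix representation has an element with abelian centraliser (a generator `g₀` of
  a maximal torus `T` has `Z(g₀) = Z(T) = T`). Mathlib has no maximal-torus theory and maximal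
  ABELIAN subgroups need not be tori (Klein four-group in `SO(3)`), so this is not soft.
* `exists_abelianisingDeformation`: hence every compact simple `G` (tree predicate
  `IsCompactSimpleLieGroup`: connected, with a faithful unitary `LatticeRep`) carries an
  abelianising deformation — conditional on `hfact` only.
* `oneLayerAnchor_of_clustering`: `OneLayerAnchor` follows from `hfact` together with the purely
  analytic statement "for EVERY abelianising `V`, the `T = 1` pinned theory clusters uniformly in
  the volume for all `β ≥ β₀`" (the clustering body of the item, verbatim) — the open part
  (Polyakov 1977; Göpfert–Mack 1982 prove the Villain `U(1)` analogue only);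
  `anchorGap_of_clustering` and `polyakovAnchorClustering_of_clustering` record the same
  reduction for the crux `AnchorGap` (stmt-QuantumFields-11141) and the support item
  `PolyakovAnchorClustering` (stmt-QuantumFields-11144), whose `V`-conjunct is identical.

Sources: T. Bröcker, T. tom Dieck, *Representations of Compact Lie Groups*, GTM 98 (1985),
I (3.11), I (4.13), IV (1.1), IV Thm (2.3)(i); R. A. Horn, C. R. Johnson, *Matrix Analysis*
(2013) Thm 2.2.2 (unitary invariance of the Frobenius norm, tree lemmas
`Matrix.frobenius_norm_unitaryGroup_mul` / `Matrix.frobenius_norm_mul_unitaryGroup`);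
A. M. Polyakov, Nucl. Phys. B 120 (1977) 429.
-/

noncomputable section

open scoped Matrix.Norms.Frobenius

namespace Summit.QuantumFields.YangMills.Theorems

open Summit.QuantumFields.YangMills.Theses.SmallCircleAnchor
open Literature.MathematicalPhysics.QuantumFieldTheory

section Deformation

variable {G : Type} [Group G] [TopologicalSpace G] [IsTopologicalGroup G] [CompactSpace G]

/-- **An abelianising deformation from an element with abelian centraliser** (route
`SmallCircleAnchor`, support item stmt-QuantumFields-11143; also the `V`-conjunct of `AnchorGap`,
stmt-QuantumFields-11141, and of `PolyakovAnchorClustering`, stmt-QuantumFields-11144). For a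
compact group `G` with a lattice representation `r` (faithful, continuous, unitary) and any
`g₀ ∈ G` whose centraliser is abelian, `V g := infDist_F (r.ρ g, r.ρ(Cl(g₀)))` (Frobenius distance
to the image of the conjugacy class) is continuous, conjugation invariant, minimised at `g₀`
(value `0`), and `V g = V g₀` forces `g ∈ Cl(g₀)`: the orbit `Cl(g₀)` is compact, so its image is
closed, and `r.ρ` is injective. Conjugation invariance: `X ↦ ρ(a) X ρ(a⁻¹)` is a Frobenius
isometry (Horn–Johnson Thm 2.2.2) mapping `r.ρ(Cl(g₀))` into itself. -/
theorem exists_abelianisingDeformation_of_abelian_centralizer (r : LatticeRep G) (g₀ : G)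
    (hab : ∀ a b : G, a * g₀ = g₀ * a → b * g₀ = g₀ * b → a * b = b * a) :
    ∃ V : G → ℝ, (Continuous V ∧ (∀ a g : G, V (a * g * a⁻¹) = V g) ∧ ∃ g₀ : G,
      (∀ g : G, V g₀ ≤ V g) ∧ (∀ g : G, V g = V g₀ → ∃ a : G, g = a * g₀ * a⁻¹) ∧
      (∀ a b : G, a * g₀ = g₀ * a → b * g₀ = g₀ * b → a * b = b * a)) := by
  classical
  -- the image of the conjugacy class of `g₀` in `M_N(ℂ)` (Frobenius norm)
  set S : Set (Matrix (Fin r.N) (Fin r.N) ℂ) := Set.range fun a : G => r.ρ (a * g₀ * a⁻¹)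
    with hS_def
  have hcont : Continuous fun a : G => r.ρ (a * g₀ * a⁻¹) :=
    r.continuous.comp ((continuous_id.mul continuous_const).mul continuous_inv)
  have hSc : IsCompact S := isCompact_range hcont
  have hSne : S.Nonempty := Set.range_nonempty _
  have h1S : r.ρ g₀ ∈ S := ⟨1, by simp⟩
  set V : G → ℝ := fun g => Metric.infDist (r.ρ g) S with hV_def
  have hV0 : V g₀ = 0 := Metric.infDist_zero_of_mem h1S
  -- conjugation does not increase `V`
  have hle : ∀ a g : G, V (a * g * a⁻¹) ≤ V g := by
    intro a g
    let φ : Matrix (Fin r.N) (Fin r.N) ℂ → Matrix (Fin r.N) (Fin r.N) ℂ :=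
      fun X => r.ρ a * X * r.ρ a⁻¹
    have hφ : Isometry φ := by
      refine Isometry.of_dist_eq fun X Y => ?_
      have h1 : ‖r.ρ a * (X - Y) * r.ρ a⁻¹‖ = ‖r.ρ a * (X - Y)‖ :=
        Matrix.frobenius_norm_mul_unitaryGroup (r.ρ a * (X - Y)) ⟨r.ρ a⁻¹, r.mem_unitary a⁻¹⟩
      have h2 : ‖r.ρ a * (X - Y)‖ = ‖X - Y‖ :=
        Matrix.frobenius_norm_unitaryGroup_mul ⟨r.ρ a, r.mem_unitary a⟩ (X - Y)
      rw [dist_eq_norm, dist_eq_norm, ← h2, ← h1, mul_sub, sub_mul]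
    have hφS : φ '' S ⊆ S := by
      rintro _ ⟨_, ⟨b, rfl⟩, rfl⟩
      refine ⟨a * b, ?_⟩
      show r.ρ (a * b * g₀ * (a * b)⁻¹) = r.ρ a * r.ρ (b * g₀ * b⁻¹) * r.ρ a⁻¹
      rw [← map_mul, ← map_mul]
      congr 1
      group
    have hφg : φ (r.ρ g) = r.ρ (a * g * a⁻¹) := by
      show r.ρ a * r.ρ g * r.ρ a⁻¹ = r.ρ (a * g * a⁻¹)
      rw [map_mul, map_mul]
    calc V (a * g * a⁻¹) = Metric.infDist (φ (r.ρ g)) S := by rw [hφg]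
      _ ≤ Metric.infDist (φ (r.ρ g)) (φ '' S) :=
          Metric.infDist_le_infDist_of_subset hφS (hSne.image φ)
      _ = Metric.infDist (r.ρ g) S := Metric.infDist_image hφ
  have hclass : ∀ a g : G, V (a * g * a⁻¹) = V g := by
    intro a g
    refine le_antisymm (hle a g) ?_
    have h := hle a⁻¹ (a * g * a⁻¹)
    rwa [show a⁻¹ * (a * g * a⁻¹) * a⁻¹⁻¹ = g by group] at h
  refine ⟨V, ⟨(Metric.continuous_infDist_pt S).comp r.continuous, hclass, g₀, ?_, ?_, hab⟩⟩
  · intro g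
    rw [hV0]
    exact Metric.infDist_nonneg
  · intro g hg
    rw [hV0] at hg
    obtain ⟨a, ha⟩ : r.ρ g ∈ S := (hSc.isClosed.mem_iff_infDist_zero hSne).2 hg
    exact ⟨a, (r.injective ha).symm⟩

/-- **Every compact simple `G` carries an abelianising deformation** (the `V`-conjunct of
`OneLayerAnchor` / `AnchorGap` / `PolyakovAnchorClustering`, route `SmallCircleAnchor`),
conditional on the hypothesis `hfact` = the named fact
`Literature.RepresentationTheory.CompactGroups.compactLie_exists_abelian_centralizer` spelled out
(Bröcker–tom Dieck IV (2.3)(i)): `IsCompactSimpleLieGroup G` gives connectedness, the lattice representation `r`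
gives the faithful continuous matrix representation, and
`exists_abelianisingDeformation_of_abelian_centralizer` builds `V`. -/
theorem exists_abelianisingDeformation (hfact : ∀ (G : Type) [Group G] [TopologicalSpace G] [IsTopologicalGroup G] [CompactSpace G]
      [ConnectedSpace G] (N : ℕ) (ρ : G →* Matrix (Fin N) (Fin N) ℂ), Continuous ρ →
      Function.Injective ρ → ∃ g₀ : G, ∀ a b : G, a * g₀ = g₀ * a → b * g₀ = g₀ * b → a * b = b * a)
    (hG : IsCompactSimpleLieGroup G) (r : LatticeRep G) :
    ∃ V : G → ℝ, (Continuous V ∧ (∀ a g : G, V (a * g * a⁻¹) = V g) ∧ ∃ g₀ : G,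
      (∀ g : G, V g₀ ≤ V g) ∧ (∀ g : G, V g = V g₀ → ∃ a : G, g = a * g₀ * a⁻¹) ∧
      (∀ a b : G, a * g₀ = g₀ * a → b * g₀ = g₀ * b → a * b = b * a)) := by
  haveI : ConnectedSpace G := hG.1.1
  obtain ⟨g₀, hab⟩ := hfact G r.N r.ρ r.continuous r.injective
  exact exists_abelianisingDeformation_of_abelian_centralizer r g₀ hab

end Deformation

/-- **`OneLayerAnchor` reduced to pure clustering** (route `SmallCircleAnchor`, support item
stmt-QuantumFields-11143). Assume `hfact` (the named fact
`compactLie_exists_abelian_centralizer`, Bröcker–tom Dieck IV (2.3)(i), spelled out) and the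
ANALYTIC statement: for every compact simple `G`, every
faithful unitary `r` and EVERY abelianising deformation `V`, the one-time-layer pinned Wilson
theory on `ℤ₁ × (ℤ/L)³` with weight `exp(β Σ_P Re tr r.ρ(U_P) − E(β) Σ_x V(u_x))` clusters
exponentially in space uniformly in `L` for all `β ≥ β₀` along some schedule `E ≥ ε₁` (the
clustering body of `OneLayerAnchor`, verbatim — Polyakov's 1977 confinement mechanism for the
three-dimensional Georgi–Glashow / Borgs–Seiler one-layer model, the open part). Then
`OneLayerAnchor` holds, with the deformation of `exists_abelianisingDeformation`. -/
theorem oneLayerAnchor_of_clustering (hfact : ∀ (G : Type) [Group G] [TopologicalSpace G] [IsTopologicalGroup G] [CompactSpace G]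
      [ConnectedSpace G] (N : ℕ) (ρ : G →* Matrix (Fin N) (Fin N) ℂ), Continuous ρ →
      Function.Injective ρ → ∃ g₀ : G, ∀ a b : G, a * g₀ = g₀ * a → b * g₀ = g₀ * b → a * b = b * a)
    (hcl : ∀ (G : Type) [Group G] [TopologicalSpace G] [IsTopologicalGroup G] [CompactSpace G],
      IsCompactSimpleLieGroup G → letI : MeasurableSpace G := borel G;
      haveI : BorelSpace G := ⟨rfl⟩; ∀ (r : LatticeRep G) (V : G → ℝ),
      (Continuous V ∧ (∀ a g : G, V (a * g * a⁻¹) = V g) ∧ ∃ g₀ : G, (∀ g : G, V g₀ ≤ V g) ∧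
        (∀ g : G, V g = V g₀ → ∃ a : G, g = a * g₀ * a⁻¹) ∧
        (∀ a b : G, a * g₀ = g₀ * a → b * g₀ = g₀ * b → a * b = b * a)) →
      ∀ ε₁ : ℝ, ∃ E : ℝ → ℝ, (∀ β : ℝ, ε₁ ≤ E β) ∧ ∃ β₀ : ℝ, ∀ β : ℝ, β₀ ≤ β → ∃ m : ℝ, 0 < m ∧
      ∀ w : ℕ, ∃ C : ℝ, ∀ (L : ℕ) [NeZero L],
      let St := ZMod 1 × (Fin 3 → ZMod L)
      let Cfg := St × Option (Fin 3) → G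
      let ν : MeasureTheory.Measure Cfg := MeasureTheory.Measure.pi fun _ => haarProbability G
      let sh : St → Option (Fin 3) → St :=
        fun x μ => Option.elim μ (x.1 + 1, x.2) fun i => (x.1, x.2 + Pi.single i 1)
      let pl : Cfg → St → Option (Fin 3) → Option (Fin 3) → G :=
        fun U x μ κ => U (x, μ) * U (sh x μ, κ) * (U (sh x κ, μ))⁻¹ * (U (x, κ))⁻¹
      let act : Cfg → ℝ := fun U =>
        β * ∑ x : St, ∑ i : Fin 3, (r.ρ (pl U x none (some i))).trace.re +
          β * ∑ x : St, ∑ q : {q : Fin 3 × Fin 3 // q.1 < q.2},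
            (r.ρ (pl U x (some q.1.1) (some q.1.2))).trace.re
      let P : Cfg → (Fin 3 → ZMod L) → G :=
        fun U x => (List.ofFn fun t : Fin 1 => U ((((t : ℕ) : ZMod 1), x), none)).prod
      let wgt : Cfg → ℝ := fun U => Real.exp (act U - E β * ∑ x : Fin 3 → ZMod L, V (P U x))
      let Ex : (Cfg → ℝ) → ℝ := fun F => (∫ U, F U * wgt U ∂ν) / (∫ U, wgt U ∂ν)
      let σ : ℕ → Cfg → Cfg := fun n U p => U ((p.1.1, p.1.2 + Pi.single 0 (n : ZMod L)), p.2)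
      ∀ (c : Fin 3 → ZMod L),
      let Loc := fun F : Cfg → ℝ => Measurable F ∧ (∀ U, |F U| ≤ 1) ∧
        ∀ U U', (∀ p, (∀ i : Fin 3, (p.1.2 i - c i).val ≤ w) → U p = U' p) → F U = F U'
      ∀ F₁ F₂ : Cfg → ℝ, Loc F₁ → Loc F₂ → ∀ n : ℕ, 2 * n < L →
        |Ex (fun U => F₁ U * F₂ (σ n U)) - Ex F₁ * Ex (fun U => F₂ (σ n U))| ≤
          C * Real.exp (-(m * n))) :
    OneLayerAnchor := by
  intro G _ _ _ _ hG r
  obtain ⟨V, hV⟩ := exists_abelianisingDeformation hfact hG r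
  exact ⟨V, hV, hcl G hG r V hV⟩

/-- **`AnchorGap` reduced to pure clustering** (route `SmallCircleAnchor`, crux
stmt-QuantumFields-11141, recorded here because its `V`-conjunct is the one settled above).
Assume `hfact` (the named fact `compactLie_exists_abelian_centralizer`, spelled out) and the
ANALYTIC statement: for every compact simple `G`, every faithful unitary `r`, EVERY abelianising
deformation `V` and every temporal extent `T ≥ 1`, the pinned finite-temperature Wilson theory on
`ℤ_T × (ℤ/L)³` clusters exponentially in space uniformly in `L` for all `β ≥ β₀(T)` along some
schedule `E ≥ ε₁` (the clustering body of `AnchorGap`, verbatim, one line). Then `AnchorGap`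
holds, with the deformation of `exists_abelianisingDeformation`. -/
theorem anchorGap_of_clustering
    (hfact : ∀ (G : Type) [Group G] [TopologicalSpace G] [IsTopologicalGroup G] [CompactSpace G]
      [ConnectedSpace G] (N : ℕ) (ρ : G →* Matrix (Fin N) (Fin N) ℂ), Continuous ρ →
      Function.Injective ρ → ∃ g₀ : G, ∀ a b : G, a * g₀ = g₀ * a → b * g₀ = g₀ * b → a * b = b * a)
    (hcl : ∀ (G : Type) [Group G] [TopologicalSpace G] [IsTopologicalGroup G] [CompactSpace G],
      IsCompactSimpleLieGroup G → letI : MeasurableSpace G := borel G;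
      haveI : BorelSpace G := ⟨rfl⟩; ∀ (r : LatticeRep G) (V : G → ℝ),
      (Continuous V ∧ (∀ a g : G, V (a * g * a⁻¹) = V g) ∧ ∃ g₀ : G, (∀ g : G, V g₀ ≤ V g) ∧
        (∀ g : G, V g = V g₀ → ∃ a : G, g = a * g₀ * a⁻¹) ∧
        (∀ a b : G, a * g₀ = g₀ * a → b * g₀ = g₀ * b → a * b = b * a)) →
      ∀ (T : ℕ) [NeZero T], ∀ ε₁ : ℝ, ∃ E : ℝ → ℝ, (∀ β : ℝ, ε₁ ≤ E β) ∧ ∃ β₀ : ℝ, ∀ β : ℝ, β₀ ≤ β → ∃ m : ℝ, 0 < m ∧ ∀ w : ℕ, ∃ C : ℝ, ∀ (L : ℕ) [NeZero L], let St := ZMod T × (Fin 3 → ZMod L); let Cfg := St × Option (Fin 3) → G; let ν : MeasureTheory.Measure Cfg := MeasureTheory.Measure.pi fun _ => haarProbability G; let sh : St → Option (Fin 3) → St := fun x μ => Option.elim μ (x.1 + 1, x.2) fun i => (x.1, x.2 + Pi.single i 1); let pl : Cfg → St → Option (Fin 3) → Option (Fin 3) → G := fun U x μ κ => U (x, μ)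 * U (sh x μ, κ) * (U (sh x κ, μ))⁻¹ * (U (x, κ))⁻¹; let act : Cfg → ℝ := fun U => β * ∑ x : St, ∑ i : Fin 3, (r.ρ (pl U x none (some i))).trace.re + β * ∑ x : St, ∑ q : {q : Fin 3 × Fin 3 // q.1 < q.2}, (r.ρ (pl U x (some q.1.1) (some q.1.2))).trace.re; let P : Cfg → (Fin 3 → ZMod L) → G := fun U x => (List.ofFn fun t : Fin T => U ((((t : ℕ) : ZMod T), x), none)).prod; let wgt : Cfg → ℝ := fun U => Real.exp (act U - E β * ∑ x : Fin 3 → ZMod L, V (P U x)); let Ex : (Cfg → ℝ) → ℝ := fun F => (∫ U, F U * wgt U ∂ν) / (∫ U, wgt U ∂ν); let σ : ℕ → Cfg → Cfg := fun n U p => U ((p.1.1, p.1.2 + Pi.single 0 (n : ZMod L)), p.2); ∀ (c : Fin 3 → ZMod L), let Loc := fun F : Cfg → ℝ => Measurable F ∧ (∀ U, |F U| ≤ 1) ∧ ∀ U U', (∀ p, (∀ i : Fin 3, (p.1.2 i - c i).val ≤ w) → U p = U' p) → F U = F U'; ∀ F₁ F₂ : Cfg → ℝ, Loc F₁ → Loc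 F₂ → ∀ n : ℕ, 2 * n < L → |Ex (fun U => F₁ U * F₂ (σ n U)) - Ex F₁ * Ex (fun U => F₂ (σ n U))| ≤ C * Real.exp (-(m * n))) :
    AnchorGap := by
  intro G _ _ _ _ hG r
  obtain ⟨V, hV⟩ := exists_abelianisingDeformation hfact hG r
  exact ⟨V, hV, hcl G hG r V hV⟩

/-- **`PolyakovAnchorClustering` reduced to pure clustering of the Polyakov two-point function**
(route `SmallCircleAnchor`, support item stmt-QuantumFields-11144; same `V`-conjunct). Assume
`hfact` (the named fact `compactLie_exists_abelian_centralizer`, spelled out) and, for every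
compact simple `G`, faithful unitary `r`, EVERY abelianising `V` and every `T ≥ 1`, the
uniform-in-`L` exponential decay of the connected Polyakov-loop two-point function of the pinned
theory for all `β ≥ β₀(T)` (the body of `PolyakovAnchorClustering`, verbatim, one line). Then
`PolyakovAnchorClustering` holds. -/
theorem polyakovAnchorClustering_of_clustering
    (hfact : ∀ (G : Type) [Group G] [TopologicalSpace G] [IsTopologicalGroup G] [CompactSpace G]
      [ConnectedSpace G] (N : ℕ) (ρ : G →* Matrix (Fin N) (Fin N) ℂ), Continuous ρ →
      Function.Injective ρ → ∃ g₀ : G, ∀ a b : G, a * g₀ = g₀ * a → b * g₀ = g₀ * b → a * b = b * a)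
    (hcl : ∀ (G : Type) [Group G] [TopologicalSpace G] [IsTopologicalGroup G] [CompactSpace G],
      IsCompactSimpleLieGroup G → letI : MeasurableSpace G := borel G;
      haveI : BorelSpace G := ⟨rfl⟩; ∀ (r : LatticeRep G) (V : G → ℝ),
      (Continuous V ∧ (∀ a g : G, V (a * g * a⁻¹) = V g) ∧ ∃ g₀ : G, (∀ g : G, V g₀ ≤ V g) ∧
        (∀ g : G, V g = V g₀ → ∃ a : G, g = a * g₀ * a⁻¹) ∧
        (∀ a b : G, a * g₀ = g₀ * a → b * g₀ = g₀ * b → a * b = b * a)) →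
      ∀ (T : ℕ) [NeZero T], ∀ ε₁ : ℝ, ∃ E : ℝ → ℝ, (∀ β : ℝ, ε₁ ≤ E β) ∧ ∃ β₀ : ℝ, ∀ β : ℝ, β₀ ≤ β → ∃ m : ℝ, 0 < m ∧ ∃ C : ℝ, ∀ (L : ℕ) [NeZero L], let St := ZMod T × (Fin 3 → ZMod L); let Cfg := St × Option (Fin 3) → G; let ν : MeasureTheory.Measure Cfg := MeasureTheory.Measure.pi fun _ => haarProbability G; let sh : St → Option (Fin 3) → St := fun x μ => Option.elim μ (x.1 + 1, x.2) fun i => (x.1, x.2 + Pi.single i 1); let pl : Cfg → St → Option (Fin 3) → Option (Fin 3) → G := fun U x μ κ => U (x, μ) * U (sh x μ, κ) * (U (sh x κ, μ))⁻¹ * (U (x, κ))⁻¹; let act : Cfg → ℝ := fun U => β * ∑ x : St, ∑ i : Fin 3, (r.ρ (pl U x none (some i))).trace.re + β * ∑ x : St, ∑ q : {q : Fin 3 × Fin 3 // q.1 < q.2}, (r.ρ (pl U x (some q.1.1) (some q.1.2))).trace.re; let P : Cfg → (Fin 3 → ZMod L) → G := fun U x => (List.ofFn fun t : Fin T => U ((((t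 : ℕ) : ZMod T), x), none)).prod; let wgt : Cfg → ℝ := fun U => Real.exp (act U - E β * ∑ x : Fin 3 → ZMod L, V (P U x)); let Ex : (Cfg → ℝ) → ℝ := fun F => (∫ U, F U * wgt U ∂ν) / (∫ U, wgt U ∂ν); let χ := fun (U : Cfg) (x : Fin 3 → ZMod L) => (r.ρ (P U x)).trace; ∀ n : ℕ, 2 * n < L → let y : Fin 3 → ZMod L := Pi.single 0 (n : ZMod L); |Ex (fun U => (χ U 0 * (starRingEnd ℂ) (χ U y)).re) - (Ex (fun U => (χ U 0).re) * Ex (fun U => (χ U y).re) + Ex (fun U => (χ U 0).im) * Ex (fun U => (χ U y).im))| ≤ C * Real.exp (-(m * n))) :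
    PolyakovAnchorClustering := by
  intro G _ _ _ _ hG r
  obtain ⟨V, hV⟩ := exists_abelianisingDeformation hfact hG r
  exact ⟨V, hV, hcl G hG r V hV⟩

end Summit.QuantumFields.YangMills.Theorems

end

/-! ## Entry point through the landed named fact `ExistsAbelianCentralizer`

Appended by the `PolyakovAnchorClustering` prover (stmt-QuantumFields-11144): the Lie-theoretic
input is also available in the tree as the named fact
`Literature.RepresentationTheory.CompactGroups.ExistsAbelianCentralizer` (unitary form — exactly what
a `LatticeRep` supplies; implied by the general form `compactLie_exists_abelian_centralizer` via
`ExistsAbelianCentralizer.of_compactLie`).  The corollary below feeds it to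
`exists_abelianisingDeformation_of_abelian_centralizer`, so that a discharge of EITHER named fact
settles the `V`-conjunct of `AnchorGap` / `OneLayerAnchor` / `PolyakovAnchorClustering`.
-/

namespace Summit.QuantumFields.YangMills.Theorems

open Literature.MathematicalPhysics.QuantumFieldTheory

/-- **Every compact simple `G` carries an abelianising deformation**, conditional on the named
fact `Literature.RepresentationTheory.CompactGroups.ExistsAbelianCentralizer` (unitary form,
Bröcker–tom Dieck IV (2.3)(i) with I (4.13)): the faithful unitary `r` and connectedness from
`IsCompactSimpleLieGroup G` produce `g₀` with abelian centraliser, and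
`exists_abelianisingDeformation_of_abelian_centralizer` builds `V`. [folklore] -/
theorem exists_abelianisingDeformation_of_existsAbelianCentralizer
    (hLie : Literature.RepresentationTheory.CompactGroups.ExistsAbelianCentralizer.{0})
    {G : Type} [Group G] [TopologicalSpace G] [IsTopologicalGroup G] [CompactSpace G]
    (hG : IsCompactSimpleLieGroup G) (r : LatticeRep G) :
    ∃ V : G → ℝ, (Continuous V ∧ (∀ a g : G, V (a * g * a⁻¹) = V g) ∧ ∃ g₀ : G,
      (∀ g : G, V g₀ ≤ V g) ∧ (∀ g : G, V g = V g₀ → ∃ a : G, g = a * g₀ * a⁻¹) ∧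
      (∀ a b : G, a * g₀ = g₀ * a → b * g₀ = g₀ * b → a * b = b * a)) := by
  haveI : ConnectedSpace G := hG.1.1
  obtain ⟨g₀, hab⟩ := hLie G r.N r.ρ r.continuous r.injective r.mem_unitary
  exact exists_abelianisingDeformation_of_abelian_centralizer r g₀ hab

end Summit.QuantumFields.YangMills.Theorems
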